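import Mathlib
import Summits.KontsevichZagierPeriods.Zeta5Search.WedgeDictionaryDescent22Weak
import HarnessLib

/-!
# Bailey's `₇F₆` involution from the reflection symmetry of Zudilin's triple integral (cell `pub-zeta5`, seat ct-1 g25)

HONEST FRAMING: systematic search; no irrationality claim unless certified.  Identities between SPECIAL FUNCTIONS (very-well-poised
hypergeometric series and Sorokin-type Euler integrals); nothing arithmetic, nothing about `ζ(3)` or `ζ(5)`; records in print unmoved.

OUR work (Summit side).  Two of the three analytic Literature facts behind the cell's `ζ(3)`-descent files
(`WedgeDictionaryDescent22*`: `Zudilin2002.vwp_eq_integral_of_pos`, `Zudilin2004.baileyTransform`) are NOT independent: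

1. **Reflection symmetry of `J₃` (PROVED, unconditional).**  The measure-preserving involution `(x₂, x₃) ↦ (1 − x₃, 1 − x₂)` of the
   cube `[0,1]³` fixes Zudilin's kernel `Q₃ = 1 − x₁(1 − x₂(1 − x₃))` [Zudilin2002VWPIntegrals, (2)–(3)] and exchanges the Euler factors
   of the last two variables, so for ALL real parameters
   `J₃(a₀; a₁, b₃−a₃, b₂−a₂ | b₁, b₃, b₂) = J₃(a₀; a₁, a₂, a₃ | b₁, b₂, b₃)` (`sorokinIntegral_three_reflect`; the `k = 3` case of the
   remark "the change of variables `(x_{k−1},x_k) ↦ (1−x_k,1−x_{k−1})` produces an additional transformation" of the source, and the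
   `k = 3` twin of the tree's `Families.Sorokin.sorokinIntegral_sigma` for `k = 5`).  In Brown–Zudilin's generalised Beukers
   integral (23) this is the symmetry `y₁ ↔ y₂`: `J₃(p₀,p₂,p₁,p₃;q₂,q₁,q₃) = J₃(p₀,p₁,p₂,p₃;q₁,q₂,q₃)` (`J3_swap12`).
2. **Bailey's transformation is that reflection read through Zudilin's `k = 3` identity (PROVED implication, CONDITIONAL
   conclusion):** `baileyTransformClosed_of_vwp_eq_integral : vwp_eq_integral_of_pos → baileyTransformClosed` (the closed cone (2.2),
   `WeakAdmissible`; Zudilin's positive-parameter statement covers it, `vwpDual_five_eq_J_weak`) and hence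
   `baileyTransform_of_vwp_eq_integral : vwp_eq_integral_of_pos → baileyTransform`.  For weakly admissible `B`, with
   `P = B∘(1 3)` and `S = 𝔱(B)∘(1 3)∘(4 5)`, Zudilin's right-hand sides at `P` and `S` (gen-1 g10's coordinate form `vwpDual_five_eq_J`)
   are reflections of each other, so `λ(P)F̃₅(P) = λ(S)F̃₅(S)`; the factorial multisets `λ·Π` at `P` and `S` coincide
   (`{c₁₂, c₂₃, c₁₄, c₄₅, B₁, B₂, B₄, 2B₀−ΣB}`), and `F̃₅`, `Π` are `S₅`-symmetric (`vwpDual_comp_swap`, `piNorm_comp_swap`).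
   CONSEQUENCE for the cell's bookkeeping: the named facts `Zudilin2004.baileyTransformClosed` and `Zudilin2004.baileyTransform` are
   implied by `Zudilin2002.vwp_eq_integral_of_pos` (indeed by its `k = 3` instance alone); nothing is discharged unconditionally here
   beyond item 1.

No `def`, no notation: the involution `ρ₃ : (x₁, x₂, x₃) ↦ (x₁, 1 − x₃, 1 − x₂)` is written out as a lambda at each use.
-/

noncomputable section

open MeasureTheory Set Finset

namespace Summit.KontsevichZagierPeriods.Zeta5Search.BaileyFromSorokinReflection

open Literature.NumberTheory.Irrationality.Zudilin2002 (sorokinIntegral sorokinIntegrand nestedQ vwp_eq_integral_of_pos)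
open Literature.NumberTheory.Irrationality.Zudilin2004 (Admissible WeakAdmissible cParams piNorm tau baileyTransform
  baileyTransformClosed baileyTransform_of_closed vwpDual_comp_swap piNorm_comp_swap weakAdmissible_tau)
open Literature.NumberTheory.Irrationality.BrownZudilin2022 (vwpDual hOfB J3)
open Summit.KontsevichZagierPeriods.Zeta5Search.WedgeDictionary (facQ lamOf sorokinIntegral_congr3 vwpDual_five_eq_J_weak)

/-! ## 1. The reflection `(x₂, x₃) ↦ (1 − x₃, 1 − x₂)` of `ℝ³` (0-based coordinates `1, 2`) -/

/-- `ρ₃` on the coordinates. [folklore] -/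
theorem refl_apply (x : Fin 3 → ℝ) :
    (![x 0, 1 - x 2, 1 - x 1] : Fin 3 → ℝ) 0 = x 0 ∧ (![x 0, 1 - x 2, 1 - x 1] : Fin 3 → ℝ) 1 = 1 - x 2 ∧
      (![x 0, 1 - x 2, 1 - x 1] : Fin 3 → ℝ) 2 = 1 - x 1 := by
  simp

/-- `ρ₃` is an involution. [folklore] -/
theorem refl_refl (x : Fin 3 → ℝ) : (fun x : Fin 3 → ℝ => (![x 0, 1 - x 2, 1 - x 1] : Fin 3 → ℝ)) ((fun x : Fin 3 → ℝ => (![x 0, 1 - x 2, 1 - x 1] : Fin 3 → ℝ)) x) = x := by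
  ext i
  fin_cases i <;> simp

/-- `ρ₃` is measurable. [folklore] -/
theorem measurable_refl : Measurable (fun x : Fin 3 → ℝ => (![x 0, 1 - x 2, 1 - x 1] : Fin 3 → ℝ)) := by
  refine measurable_pi_lambda _ fun i => ?_
  fin_cases i <;> simp <;> fun_prop

/-- `ρ₃` is a measurable embedding (it is a measurable involution). [folklore] -/
theorem measurableEmbedding_refl : MeasurableEmbedding (fun x : Fin 3 → ℝ => (![x 0, 1 - x 2, 1 - x 1] : Fin 3 → ℝ)) :=
  (⟨⟨(fun x : Fin 3 → ℝ => (![x 0, 1 - x 2, 1 - x 1] : Fin 3 → ℝ)), (fun x : Fin 3 → ℝ => (![x 0, 1 - x 2, 1 - x 1] : Fin 3 → ℝ)), refl_refl, refl_refl⟩,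
    measurable_refl, measurable_refl⟩ : (Fin 3 → ℝ) ≃ᵐ (Fin 3 → ℝ)).measurableEmbedding

/-- `ρ₃` preserves Lebesgue measure on `ℝ³` (a swap of two coordinates followed by two reflections `t ↦ 1 − t`). [folklore] -/
theorem measurePreserving_refl : MeasurePreserving (fun x : Fin 3 → ℝ => (![x 0, 1 - x 2, 1 - x 1] : Fin 3 → ℝ)) volume volume := by
  set s : Fin 3 ≃ Fin 3 := Equiv.swap 1 2 with hs
  have hS := volume_measurePreserving_piCongrLeft (fun _ : Fin 3 => ℝ) s
  have hT : ∀ (w : Fin 3 → ℝ) (k : Fin 3), MeasurableEquiv.piCongrLeft (fun _ : Fin 3 => ℝ) s w k = w (s k) := by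
    intro w k
    have := MeasurableEquiv.piCongrLeft_apply_apply (β := fun _ : Fin 3 => ℝ) s w (s k)
    have hss : s (s k) = k := by simp [hs, Equiv.swap_apply_self]
    rw [hss] at this
    exact this
  have hf : ∀ i : Fin 3, MeasurePreserving (fun t : ℝ => if i = 1 ∨ i = 2 then 1 - t else t) volume volume := by
    intro i
    by_cases h : i = 1 ∨ i = 2
    · simp only [h, if_true]
      exact Measure.measurePreserving_sub_left volume 1
    · simp only [h, if_false]
      exact MeasurePreserving.id volume
  have hP := volume_preserving_pi hf
  have hfun : (fun x : Fin 3 → ℝ => (![x 0, 1 - x 2, 1 - x 1] : Fin 3 → ℝ)) =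
      (fun (x : Fin 3 → ℝ) (i : Fin 3) => if i = 1 ∨ i = 2 then 1 - x i else x i) ∘
      (MeasurableEquiv.piCongrLeft (fun _ : Fin 3 => ℝ) s) := by
    funext x
    funext i
    simp only [Function.comp_apply, hT]
    fin_cases i <;> simp [hs, Equiv.swap_apply_of_ne_of_ne]
  rw [hfun]
  exact hP.comp hS

/-- The cube `[0,1]³` is invariant under `ρ₃`. [folklore] -/
theorem refl_preimage_cube :
    (fun x : Fin 3 → ℝ => (![x 0, 1 - x 2, 1 - x 1] : Fin 3 → ℝ)) ⁻¹' (Set.pi Set.univ fun _ : Fin 3 => Icc (0 : ℝ) 1) =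
      Set.pi Set.univ fun _ => Icc (0 : ℝ) 1 := by
  ext x
  simp only [Set.mem_preimage, Set.mem_univ_pi, Set.mem_Icc]
  constructor
  · intro h i
    fin_cases i
    · show 0 ≤ x 0 ∧ x 0 ≤ 1
      simpa using h 0
    · show 0 ≤ x 1 ∧ x 1 ≤ 1
      have := h 2
      simp at this
      constructor <;> linarith [this.1, this.2]
    · show 0 ≤ x 2 ∧ x 2 ≤ 1
      have := h 1
      simp at this
      constructor <;> linarith [this.1, this.2]
  · intro h i
    fin_cases i
    · show 0 ≤ (![x 0, 1 - x 2, 1 - x 1] : Fin 3 → ℝ) 0 ∧ (![x 0, 1 - x 2, 1 - x 1] : Fin 3 → ℝ) 0 ≤ 1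
      simpa using h 0
    · show 0 ≤ (![x 0, 1 - x 2, 1 - x 1] : Fin 3 → ℝ) 1 ∧ (![x 0, 1 - x 2, 1 - x 1] : Fin 3 → ℝ) 1 ≤ 1
      have := h 2
      simp
      constructor <;> linarith [this.1, this.2]
    · show 0 ≤ (![x 0, 1 - x 2, 1 - x 1] : Fin 3 → ℝ) 2 ∧ (![x 0, 1 - x 2, 1 - x 1] : Fin 3 → ℝ) 2 ≤ 1
      have := h 1
      simp
      constructor <;> linarith [this.1, this.2]

/-! ## 2. The reflection symmetry of `J₃` -/

/-- The kernel `Q₃` is `ρ₃`-invariant and the Euler factors of `x₂, x₃` are exchanged with the reflected parameters: the integrand of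
`(a₀; a₁, b₃−a₃, b₂−a₂ | b₁, b₃, b₂)` at `ρ₃ x` is the integrand of `(a₀; a | b)` at `x`, for every `x ∈ ℝ³` (0-based parameter rows).
[cite: Zudilin2002VWPIntegrals, eq. (2)–(3) and the remark on `(x_{k−1},x_k) ↦ (1−x_k,1−x_{k−1})`] -/
theorem sorokinIntegrand_refl (a₀ : ℝ) (a b : ℕ → ℝ) (x : Fin 3 → ℝ) :
    sorokinIntegrand 3 a₀ (fun j => if j = 1 then b 2 - a 2 else if j = 2 then b 1 - a 1 else a j)
        (fun j => if j = 1 then b 2 else if j = 2 then b 1 else b j) (![x 0, 1 - x 2, 1 - x 1] : Fin 3 → ℝ) =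
      sorokinIntegrand 3 a₀ a b x := by
  simp [sorokinIntegrand, Fin.prod_univ_three, List.ofFn_succ, nestedQ]
  ring_nf

/-- **Reflection symmetry of Zudilin's triple integral** (all real parameters, no convergence hypothesis — both sides are the same
Bochner integral after a measure-preserving involution of the cube):
`J₃(a₀; a₁, b₃−a₃, b₂−a₂ | b₁, b₃, b₂) = J₃(a₀; a₁, a₂, a₃ | b₁, b₂, b₃)` (0-based rows: slots `1, 2` reflected).
[cite: Zudilin2002VWPIntegrals, eq. (2)–(3) and the remark on `(x_{k−1},x_k) ↦ (1−x_k,1−x_{k−1})`] -/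
theorem sorokinIntegral_three_reflect (a₀ : ℝ) (a b : ℕ → ℝ) :
    sorokinIntegral 3 a₀ (fun j => if j = 1 then b 2 - a 2 else if j = 2 then b 1 - a 1 else a j)
        (fun j => if j = 1 then b 2 else if j = 2 then b 1 else b j) =
      sorokinIntegral 3 a₀ a b := by
  unfold Literature.NumberTheory.Irrationality.Zudilin2002.sorokinIntegral
  have key := measurePreserving_refl.setIntegral_preimage_emb measurableEmbedding_refl
    (sorokinIntegrand 3 a₀ (fun j => if j = 1 then b 2 - a 2 else if j = 2 then b 1 - a 1 else a j)
      (fun j => if j = 1 then b 2 else if j = 2 then b 1 else b j)) (Set.pi Set.univ fun _ : Fin 3 => Icc (0 : ℝ) 1)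
  rw [refl_preimage_cube] at key
  rw [← key]
  congr 1
  ext x
  exact sorokinIntegrand_refl a₀ a b x

/-- **The symmetry `y₁ ↔ y₂` of Brown–Zudilin's generalised Beukers integral (23)**, as typed through `J₃`:
`J₃(p₀, p₂, p₁, p₃; q₂, q₁, q₃) = J₃(p₀, p₁, p₂, p₃; q₁, q₂, q₃)` for all integer parameters.
[cite: BrownZudilin2022, Sect. 6, eq. (23)] -/
theorem J3_swap12 (p₀ p₁ p₂ p₃ q₁ q₂ q₃ : ℤ) : J3 p₀ p₂ p₁ p₃ q₂ q₁ q₃ = J3 p₀ p₁ p₂ p₃ q₁ q₂ q₃ := by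
  unfold Literature.NumberTheory.Irrationality.BrownZudilin2022.J3
  rw [← sorokinIntegral_three_reflect ((p₀ : ℝ) + 1)
    (fun i => if i = 0 then (p₃ : ℝ) + 1 else if i = 1 then (p₁ : ℝ) + 1 else (q₂ : ℝ) + 1)
    (fun i => if i = 0 then (p₃ : ℝ) + q₃ + 2 else if i = 1 then (p₁ : ℝ) + q₁ + 2 else (p₂ : ℝ) + q₂ + 2)]
  refine sorokinIntegral_congr3 rfl ?_ ?_
  · intro i hi
    interval_cases i <;> simp <;> ring
  · intro i hi
    interval_cases i <;> simp

/-! ## 3. Bailey's involution from the reflection (on the closed cone (2.2), hence on the admissible cone) -/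

/-- Weak admissibility is symmetric under the transposition of the slots `1, 3`. [cite: Zudilin2004, Sect. 4, (4.7)] -/
theorem weakAdmissible_comp_swap13 {B : ℕ → ℤ} (hB : WeakAdmissible B) : WeakAdmissible (B ∘ Equiv.swap 1 3) := by
  unfold WeakAdmissible cParams at hB ⊢
  simp only [List.mem_cons, List.not_mem_nil, or_false, forall_eq_or_imp, forall_eq] at hB ⊢
  have s0 : Equiv.swap (1 : ℕ) 3 0 = 0 := Equiv.swap_apply_of_ne_of_ne (by norm_num) (by norm_num)
  have s2 : Equiv.swap (1 : ℕ) 3 2 = 2 := Equiv.swap_apply_of_ne_of_ne (by norm_num) (by norm_num)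
  have s4 : Equiv.swap (1 : ℕ) 3 4 = 4 := Equiv.swap_apply_of_ne_of_ne (by norm_num) (by norm_num)
  have s5 : Equiv.swap (1 : ℕ) 3 5 = 5 := Equiv.swap_apply_of_ne_of_ne (by norm_num) (by norm_num)
  have s1 : Equiv.swap (1 : ℕ) 3 1 = 3 := Equiv.swap_apply_left _ _
  have s3 : Equiv.swap (1 : ℕ) 3 3 = 1 := Equiv.swap_apply_right _ _
  simp only [Function.comp, s0, s1, s2, s3, s4, s5]
  omega

/-- Weak admissibility is symmetric under the transposition of the slots `4, 5`. [cite: Zudilin2004, Sect. 4, (4.7)] -/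
theorem weakAdmissible_comp_swap45 {B : ℕ → ℤ} (hB : WeakAdmissible B) : WeakAdmissible (B ∘ Equiv.swap 4 5) := by
  unfold WeakAdmissible cParams at hB ⊢
  simp only [List.mem_cons, List.not_mem_nil, or_false, forall_eq_or_imp, forall_eq] at hB ⊢
  have s0 : Equiv.swap (4 : ℕ) 5 0 = 0 := Equiv.swap_apply_of_ne_of_ne (by norm_num) (by norm_num)
  have s1 : Equiv.swap (4 : ℕ) 5 1 = 1 := Equiv.swap_apply_of_ne_of_ne (by norm_num) (by norm_num)
  have s2 : Equiv.swap (4 : ℕ) 5 2 = 2 := Equiv.swap_apply_of_ne_of_ne (by norm_num) (by norm_num)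
  have s3 : Equiv.swap (4 : ℕ) 5 3 = 3 := Equiv.swap_apply_of_ne_of_ne (by norm_num) (by norm_num)
  have s4 : Equiv.swap (4 : ℕ) 5 4 = 5 := Equiv.swap_apply_left _ _
  have s5 : Equiv.swap (4 : ℕ) 5 5 = 4 := Equiv.swap_apply_right _ _
  simp only [Function.comp, s0, s1, s2, s3, s4, s5]
  omega

/-- **CONDITIONAL REDUCTION (no discharge; named-fact debt unchanged): Bailey's transformation on the closed cone (2.2),
`Zudilin2004.baileyTransformClosed`, from Zudilin's integral identity `Zudilin2002.vwp_eq_integral_of_pos` (used at `k = 3`).**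
For weakly admissible `B`,
put `P = B∘(1 3)` and `S = 𝔱(B)∘(1 3)∘(4 5)`; then Zudilin's right-hand side at `S` is the reflection (`sorokinIntegral_three_reflect`)
of the one at `P`, so `λ(P)·F̃₅(P) = λ(S)·F̃₅(S)` (`vwpDual_five_eq_J_weak`), while `λ(P)Π(P) = λ(S)Π(S)` (the same eight factorials)
and `F̃₅`, `Π` are `S₅`-symmetric; hence `F̃₅(B)/Π(B) = F̃₅(𝔱B)/Π(𝔱B)`.
[cite: Zudilin2004, Sect. 4, Lemma 7 with (4.4)–(4.6), on (2.2); Zudilin2002VWPIntegrals, Theorem (eq. (4))] -/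
theorem baileyTransformClosed_of_vwp_eq_integral
    (hZ : Literature.NumberTheory.Irrationality.Zudilin2002.vwp_eq_integral_of_pos) :
    Literature.NumberTheory.Irrationality.Zudilin2004.baileyTransformClosed := by
  intro B hB
  have h1 : (1 : ℕ) ∈ Finset.Icc 1 5 := by simp
  have h3 : (3 : ℕ) ∈ Finset.Icc 1 5 := by simp
  have h4 : (4 : ℕ) ∈ Finset.Icc 1 5 := by simp
  have h5 : (5 : ℕ) ∈ Finset.Icc 1 5 := by simp
  -- the two auxiliary vectors
  set P : ℕ → ℤ := B ∘ Equiv.swap 1 3 with hPdef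
  set S : ℕ → ℤ := (tau B ∘ Equiv.swap 1 3) ∘ Equiv.swap 4 5 with hSdef
  have hP : WeakAdmissible P := weakAdmissible_comp_swap13 hB
  have hS : WeakAdmissible S := weakAdmissible_comp_swap45 (weakAdmissible_comp_swap13 (weakAdmissible_tau hB))
  -- their coordinates
  have s130 : Equiv.swap (1 : ℕ) 3 0 = 0 := Equiv.swap_apply_of_ne_of_ne (by norm_num) (by norm_num)
  have s132 : Equiv.swap (1 : ℕ) 3 2 = 2 := Equiv.swap_apply_of_ne_of_ne (by norm_num) (by norm_num)
  have s134 : Equiv.swap (1 : ℕ) 3 4 = 4 := Equiv.swap_apply_of_ne_of_ne (by norm_num) (by norm_num)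
  have s135 : Equiv.swap (1 : ℕ) 3 5 = 5 := Equiv.swap_apply_of_ne_of_ne (by norm_num) (by norm_num)
  have s131 : Equiv.swap (1 : ℕ) 3 1 = 3 := Equiv.swap_apply_left _ _
  have s133 : Equiv.swap (1 : ℕ) 3 3 = 1 := Equiv.swap_apply_right _ _
  have s450 : Equiv.swap (4 : ℕ) 5 0 = 0 := Equiv.swap_apply_of_ne_of_ne (by norm_num) (by norm_num)
  have s451 : Equiv.swap (4 : ℕ) 5 1 = 1 := Equiv.swap_apply_of_ne_of_ne (by norm_num) (by norm_num)
  have s452 : Equiv.swap (4 : ℕ) 5 2 = 2 := Equiv.swap_apply_of_ne_of_ne (by norm_num) (by norm_num)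
  have s453 : Equiv.swap (4 : ℕ) 5 3 = 3 := Equiv.swap_apply_of_ne_of_ne (by norm_num) (by norm_num)
  have s454 : Equiv.swap (4 : ℕ) 5 4 = 5 := Equiv.swap_apply_left _ _
  have s455 : Equiv.swap (4 : ℕ) 5 5 = 4 := Equiv.swap_apply_right _ _
  have tau0 : tau B 0 = B 0 + (B 0 - B 1 - B 4 - B 5) := if_pos (by decide)
  have tau1 : tau B 1 = B 1 + (B 0 - B 1 - B 4 - B 5) := if_pos (by decide)
  have tau2 : tau B 2 = B 2 := if_neg (by decide)
  have tau3 : tau B 3 = B 3 := if_neg (by decide)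
  have tau4 : tau B 4 = B 4 + (B 0 - B 1 - B 4 - B 5) := if_pos (by decide)
  have tau5 : tau B 5 = B 5 + (B 0 - B 1 - B 4 - B 5) := if_pos (by decide)
  have eP0 : P 0 = B 0 := by rw [hPdef]; simp only [Function.comp_apply, s130]
  have eP1 : P 1 = B 3 := by rw [hPdef]; simp only [Function.comp_apply, s131]
  have eP2 : P 2 = B 2 := by rw [hPdef]; simp only [Function.comp_apply, s132]
  have eP3 : P 3 = B 1 := by rw [hPdef]; simp only [Function.comp_apply, s133]
  have eP4 : P 4 = B 4 := by rw [hPdef]; simp only [Function.comp_apply, s134]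
  have eP5 : P 5 = B 5 := by rw [hPdef]; simp only [Function.comp_apply, s135]
  have eS0 : S 0 = 2 * B 0 - B 1 - B 4 - B 5 := by
    rw [hSdef]; simp only [Function.comp_apply, s450, s130]; rw [tau0]; ring
  have eS1 : S 1 = B 3 := by rw [hSdef]; simp only [Function.comp_apply, s451, s131, tau3]
  have eS2 : S 2 = B 2 := by rw [hSdef]; simp only [Function.comp_apply, s452, s132, tau2]
  have eS3 : S 3 = B 0 - B 4 - B 5 := by
    rw [hSdef]; simp only [Function.comp_apply, s453, s133]; rw [tau1]; ring
  have eS4 : S 4 = B 0 - B 1 - B 4 := by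
    rw [hSdef]; simp only [Function.comp_apply, s454, s135]; rw [tau5]; ring
  have eS5 : S 5 = B 0 - B 1 - B 5 := by
    rw [hSdef]; simp only [Function.comp_apply, s455, s134]; rw [tau4]; ring
  -- Zudilin at `P` and at `S`; the right-hand sides are reflections of each other
  have zP := vwpDual_five_eq_J_weak hZ P hP
  have zS := vwpDual_five_eq_J_weak hZ S hS
  have hrefl : sorokinIntegral 3 ((S 1 : ℝ) + 1) (fun i => (S (i + 2) : ℝ) + 1) (fun i => (S 0 : ℝ) - S (i + 3) + 2) =
      sorokinIntegral 3 ((P 1 : ℝ) + 1) (fun i => (P (i + 2) : ℝ) + 1) (fun i => (P 0 : ℝ) - P (i + 3) + 2) := by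
    rw [← sorokinIntegral_three_reflect ((P 1 : ℝ) + 1) (fun i => (P (i + 2) : ℝ) + 1) (fun i => (P 0 : ℝ) - P (i + 3) + 2)]
    refine sorokinIntegral_congr3 ?_ ?_ ?_
    · rw [eS1, eP1]
    · intro i hi
      interval_cases i <;> simp [eS2, eS3, eS4, eP0, eP2, eP3, eP4, eP5] <;> ring
    · intro i hi
      interval_cases i <;> simp [eS0, eS3, eS4, eS5, eP0, eP3, eP4, eP5] <;> ring
  have hFF : (lamOf P : ℝ) * vwpDual 5 P = (lamOf S : ℝ) * vwpDual 5 S := by rw [zP, zS, hrefl]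
  -- the factorial identity `λ(P)Π(P) = λ(S)Π(S)` and non-vanishing
  have hsumP : 2 * P 0 - ∑ j ∈ range 5, P (j + 1) = 2 * B 0 - (B 1 + B 2 + B 3 + B 4 + B 5) := by
    simp only [sum_range_succ, sum_range_zero, zero_add, eP1, eP2, eP3, eP4, eP5, eP0]; ring
  have hsumS : 2 * S 0 - ∑ j ∈ range 5, S (j + 1) = B 0 - B 2 - B 3 := by
    simp only [sum_range_succ, sum_range_zero, zero_add, eS1, eS2, eS3, eS4, eS5, eS0]; ring
  have hPiP : (piNorm P : ℚ) = facQ (B 3) * facQ (B 2) * facQ (B 1) * facQ (B 4) * facQ (B 5) *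
      facQ (2 * B 0 - (B 1 + B 2 + B 3 + B 4 + B 5)) := by
    unfold piNorm; rw [hsumP]; simp [prod_range_succ, facQ, eP1, eP2, eP3, eP4, eP5]
  have hPiS : (piNorm S : ℚ) = facQ (B 3) * facQ (B 2) * facQ (B 0 - B 4 - B 5) * facQ (B 0 - B 1 - B 4) * facQ (B 0 - B 1 - B 5) *
      facQ (B 0 - B 2 - B 3) := by
    unfold piNorm; rw [hsumS]; simp [prod_range_succ, facQ, eS1, eS2, eS3, eS4, eS5]
  have hLamP : lamOf P = facQ (B 0 - B 3 - B 2) * facQ (B 0 - B 2 - B 1) * facQ (B 0 - B 1 - B 4) * facQ (B 0 - B 4 - B 5) /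
      (facQ (B 3) * facQ (B 5)) := by
    simp only [lamOf, eP0, eP1, eP2, eP3, eP4, eP5]
  have hLamS : lamOf S = facQ (2 * B 0 - (B 1 + B 2 + B 3 + B 4 + B 5)) * facQ (B 0 - B 2 - B 1) * facQ (B 4) * facQ (B 1) /
      (facQ (B 3) * facQ (B 0 - B 1 - B 5)) := by
    simp only [lamOf, eS0, eS1, eS2, eS3, eS4, eS5]
    congr 1
    · rw [show 2 * B 0 - B 1 - B 4 - B 5 - B 3 - B 2 = 2 * B 0 - (B 1 + B 2 + B 3 + B 4 + B 5) by ring,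
        show 2 * B 0 - B 1 - B 4 - B 5 - B 2 - (B 0 - B 4 - B 5) = B 0 - B 2 - B 1 by ring,
        show 2 * B 0 - B 1 - B 4 - B 5 - (B 0 - B 4 - B 5) - (B 0 - B 1 - B 4) = B 4 by ring,
        show 2 * B 0 - B 1 - B 4 - B 5 - (B 0 - B 1 - B 4) - (B 0 - B 1 - B 5) = B 1 by ring]
  have fac_pos : ∀ z : ℤ, (0 : ℚ) < facQ z := fun z => by
    unfold facQ; exact_mod_cast Nat.factorial_pos _
  have hLamPi : lamOf P * (piNorm P : ℚ) = lamOf S * (piNorm S : ℚ) := by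
    rw [hLamP, hLamS, hPiP, hPiS]
    rw [show B 0 - B 3 - B 2 = B 0 - B 2 - B 3 by ring]
    have hDP : facQ (B 3) * facQ (B 5) ≠ 0 := (mul_pos (fac_pos _) (fac_pos _)).ne'
    have hDS : facQ (B 3) * facQ (B 0 - B 1 - B 5) ≠ 0 := (mul_pos (fac_pos _) (fac_pos _)).ne'
    rw [div_mul_eq_mul_div, div_mul_eq_mul_div, div_eq_div_iff hDP hDS]
    ring
  have hLamP0 : (lamOf P : ℝ) ≠ 0 := by
    rw [hLamP]; push_cast
    have := fac_pos (B 0 - B 3 - B 2); have := fac_pos (B 0 - B 2 - B 1); have := fac_pos (B 0 - B 1 - B 4)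
    have := fac_pos (B 0 - B 4 - B 5); have := fac_pos (B 3); have := fac_pos (B 5)
    positivity
  have hLamS0 : (lamOf S : ℝ) ≠ 0 := by
    rw [hLamS]; push_cast
    have := fac_pos (2 * B 0 - (B 1 + B 2 + B 3 + B 4 + B 5)); have := fac_pos (B 0 - B 2 - B 1); have := fac_pos (B 4)
    have := fac_pos (B 1); have := fac_pos (B 3); have := fac_pos (B 0 - B 1 - B 5)
    positivity
  have hPiP0 : (piNorm P : ℝ) ≠ 0 := by
    unfold piNorm; exact_mod_cast Nat.mul_ne_zero (prod_ne_zero_iff.2 fun _ _ => Nat.factorial_ne_zero _) (Nat.factorial_ne_zero _)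
  have hPiS0 : (piNorm S : ℝ) ≠ 0 := by
    unfold piNorm; exact_mod_cast Nat.mul_ne_zero (prod_ne_zero_iff.2 fun _ _ => Nat.factorial_ne_zero _) (Nat.factorial_ne_zero _)
  have hLamPiR : (lamOf P : ℝ) * (piNorm P : ℝ) = (lamOf S : ℝ) * (piNorm S : ℝ) := by
    have := congrArg (fun q : ℚ => (q : ℝ)) hLamPi
    push_cast at this
    exact this
  -- assemble: `F̃(P)/Π(P) = F̃(S)/Π(S)`
  have main : vwpDual 5 P / (piNorm P : ℝ) = vwpDual 5 S / (piNorm S : ℝ) := by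
    rw [div_eq_div_iff hPiP0 hPiS0]
    have e1 : vwpDual 5 P = (lamOf S : ℝ) * vwpDual 5 S / (lamOf P : ℝ) := by
      rw [eq_div_iff hLamP0, mul_comm]; exact hFF
    rw [e1, div_mul_eq_mul_div, div_eq_iff hLamP0]
    calc (lamOf S : ℝ) * vwpDual 5 S * (piNorm S : ℝ)
        = vwpDual 5 S * ((lamOf S : ℝ) * (piNorm S : ℝ)) := by ring
      _ = vwpDual 5 S * ((lamOf P : ℝ) * (piNorm P : ℝ)) := by rw [hLamPiR]
      _ = vwpDual 5 S * (piNorm P : ℝ) * (lamOf P : ℝ) := by ring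
  -- transport back to `B` and `𝔱 B` by the `S₅`-symmetry
  have eFP : vwpDual 5 P = vwpDual 5 B := by rw [hPdef]; exact vwpDual_comp_swap 5 B h1 h3
  have ePiP : piNorm P = piNorm B := by rw [hPdef]; exact piNorm_comp_swap B h1 h3
  have eFS : vwpDual 5 S = vwpDual 5 (tau B) := by
    rw [hSdef, vwpDual_comp_swap 5 _ h4 h5, vwpDual_comp_swap 5 _ h1 h3]
  have ePiS : piNorm S = piNorm (tau B) := by
    rw [hSdef, piNorm_comp_swap _ h4 h5, piNorm_comp_swap _ h1 h3]
  rw [← eFP, ← ePiP, ← eFS, ← ePiS]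
  exact main

/-- **CONDITIONAL REDUCTION (no discharge; named-fact debt unchanged): Bailey's transformation on the admissible cone (4.12),
`Zudilin2004.baileyTransform`, from Zudilin's integral identity `Zudilin2002.vwp_eq_integral_of_pos`** (the closed-cone reduction
restricted by the tree's `baileyTransform_of_closed`). [cite: Zudilin2004, Sect. 4, Lemma 7 with (4.4)–(4.6); Zudilin2002VWPIntegrals, Theorem (eq. (4))] -/
theorem baileyTransform_of_vwp_eq_integral
    (hZ : Literature.NumberTheory.Irrationality.Zudilin2002.vwp_eq_integral_of_pos) :
    Literature.NumberTheory.Irrationality.Zudilin2004.baileyTransform :=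
  baileyTransform_of_closed (baileyTransformClosed_of_vwp_eq_integral hZ)

end Summit.KontsevichZagierPeriods.Zeta5Search.BaileyFromSorokinReflection
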